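import Literature.NumberTheory.Sieve.LargestPrimeFactorCubicDivisorSet
import Literature.NumberTheory.Sieve.LargestPrimeFactorCubicSmallPart
import Literature.NumberTheory.Sieve.HeathBrownCubicChainSums
import Literature.NumberTheory.Sieve.RoughNumbersInProgressions
import Mathlib.NumberTheory.Harmonic.Bounds
import Mathlib.Data.Nat.Squarefree
import HarnessLib

/-!
# Irving 2015, Lemma 3.2: `T(h,δ) ≤ X(c(h,δ) + o(1))`, `c(h,δ) = (1/k!)(log((3−(k−1)δ)/((h−k+1)δ)))^k`

Fifth proved layer under the named fact `Irving2015_largestPrimeFactor_cubic`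
(`LargestPrimeFactorCubic.lean`; A. J. Irving, arXiv:1412.0024 = Acta Arith. 171 (2015)).
`T(h,δ)` is the number of `n ∈ (X, 2X]` such that `n³ + 2` has at least `h` prime factors
`≥ X^δ` counted with multiplicity; Lemma 3.2 is the first of Irving's two estimates for it and the
one he uses for `h ≥ 190` in §5.  Everything here is PROVED:

* `Irving2015.card_largeOmega_le_bound` — the estimate of p. 5 before any analysis:
  `T ≤ X·((∑_{p∈𝒫} ν(p)/p)^k/k! + W^k(1 + log 3X)(2/z)) + W^k K(3X/log z + z^{10})`, where
  `z` is the threshold, `𝒫` the admissible primes (`z ≤ p`, `z^{k-1}p^{h-k+1} ≤ 10X³`), `W` the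
  uniform bound for `ν` on prime powers and `K` the sieve constant: `T ≤ ∑_{d∈𝒟} A_d`
  (`card_largeOmega_le_sum_divisorSet`), `A_d ≤ ν(d)(X/d + 1)` (`card_Ioc_filter_dvd_le`),
  `ν(d) ≤ W^{ω(d)}` (`rootCount_le_pow_cardDistinctFactors`, multiplicativity of `ν(d)/d`), the
  squarefree `d` through the elementary symmetric sum `e_k` and the tree's
  `CubicSieve.esymm_le_pow_div_factorial` (`sum_squarefree_rootCount_div_le`), the others through
  `p² ∣ d`, `p ≥ z` (`sum_nonsquarefree_rootCount_div_le`: `≤ W^k(1 + log 3X)·2/z`), and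
  `#𝒟 ≤ #{d ≤ 3X : (d, P(z)) = 1} ≤ K(3X/log z + z^{10})` (`card_divisorSet_le`, the tree's
  upper-bound sieve `card_roughAP_le`);
* `Irving2015.irving_lemma_3_2` — **Lemma 3.2**: for `0 < δ ≤ 1/20`, `h ≥ 3`, `k = [h/3]`,
  `(h−k+1)δ ≤ 3 − (k−1)δ` and `ε > 0`, for all large `X`,
  `#{n ∈ (X,2X] : Ω_{⌈X^δ⌉}(n³+2) ≥ h} ≤ (c(h,δ) + ε)·X`; the prime sum is `M(Z) − M(z−1)` with
  `Z = (10X³/z^{k-1})^{1/(h-k+1)}`, evaluated by Mertens' theorem for `ν` with rate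
  (`exists_sum_rootCount_div_eq`, from the tree's prime ideal theorem `DegreeOnePrimesPNT`):
  `log(log Z/log(z−1)) → log((3−(k−1)δ)/((h−k+1)δ))`.

Restrictions relative to the printed lemma (`δ ∈ (0,1)`, `h ≥ 3`): `δ ≤ 1/20` (so that the
sieve's `z^{10}` is harmless) and `(h−k+1)δ ≤ 3 − (k−1)δ` (so that the logarithm is `≥ 0`; for
larger `h` the set is empty anyway); the application in §5 has `δ = 1/321`, `190 ≤ h ≤ 963`.

## References

* A. J. Irving, *The largest prime factor of `X³ + 2`*, arXiv:1412.0024; Acta Arith. 171 (2015)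
  67–80, §3, Lemma 3.2 and the displays before it. [`Irving2014LargestPrimeFactorCubic`]
* H. G. Diamond, H. Halberstam, *A higher-dimensional sieve method*, CUP 2008 (cited by Irving for
  `∑ ν(p) log p/p = log x + O(1)`); here replaced by the tree's Landau prime ideal theorem.
-/

noncomputable section

open Finset

namespace Literature.NumberTheory.Sieve

namespace Irving2015

/-! ## The divisor-set sums (Irving §3, displays between Lemma 3.1 and Lemma 3.2) -/

section DivisorSums

/-- `ν(d) ≤ W^{ω(d)}` for `d ≠ 0`, from the multiplicativity of `d ↦ ν(d)/d`
(`isMultiplicative_rootDensity`) and the uniform prime-power bound `ν(p^a) ≤ W`.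
(Irving: "`ν(d) ≪_δ 1`" for `d` with at most `[1/δ]` prime factors.)
[cite: Irving2014LargestPrimeFactorCubic, §3 (p. 5)] -/
theorem rootCount_le_pow_cardDistinctFactors {W : ℕ}
    (hW : ∀ p : ℕ, p.Prime → ∀ a : ℕ, #((range (p ^ a)).filter fun s : ℕ => p ^ a ∣ s ^ 3 + 2) ≤ W)
    {d : ℕ} (hd : d ≠ 0) :
    (#((range d).filter fun s : ℕ => d ∣ s ^ 3 + 2) : ℝ) ≤
      (W : ℝ) ^ ArithmeticFunction.cardDistinctFactors d := by
  have hmult := isMultiplicative_rootDensity (Polynomial.X ^ 3 + Polynomial.C 2 : Polynomial ℤ)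
  have hfac := ArithmeticFunction.IsMultiplicative.multiplicative_factorization _ hmult hd
  rw [Nat.prod_factorization_eq_prod_primeFactors] at hfac
  -- `ν(d)/d = ∏_p ν(p^a)/p^a ≤ ∏_p W/p^a = W^ω / d`
  have hρ : rootDensity (Polynomial.X ^ 3 + Polynomial.C 2 : Polynomial ℤ) d =
      (#((range d).filter fun s : ℕ => d ∣ s ^ 3 + 2) : ℝ) / d := by
    rw [rootDensity_apply, polyRootCountMod_eq_card]
  have hle : rootDensity (Polynomial.X ^ 3 + Polynomial.C 2 : Polynomial ℤ) d ≤
      ∏ p ∈ d.primeFactors, (W : ℝ) / (p : ℝ) ^ d.factorization p := by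
    rw [hfac]
    refine Finset.prod_le_prod (fun p _ => rootDensity_nonneg _ _) (fun p hp => ?_)
    have hpp := Nat.prime_of_mem_primeFactors hp
    rw [rootDensity_apply, polyRootCountMod_eq_card]
    push_cast
    exact div_le_div_of_nonneg_right (by exact_mod_cast hW p hpp _) (by positivity)
  have hcard : d.primeFactors.card = ArithmeticFunction.cardDistinctFactors d := by
    rw [ArithmeticFunction.cardDistinctFactors_apply, ← List.card_toFinset, Nat.toFinset_factors]
  have hdprod : ∏ p ∈ d.primeFactors, (p : ℝ) ^ d.factorization p = d := by
    have := Nat.prod_factorization_pow_eq_self hd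
    rw [Nat.prod_factorization_eq_prod_primeFactors] at this
    exact_mod_cast this
  have hprod : ∏ p ∈ d.primeFactors, (W : ℝ) / (p : ℝ) ^ d.factorization p =
      (W : ℝ) ^ ArithmeticFunction.cardDistinctFactors d / d := by
    rw [Finset.prod_div_distrib, Finset.prod_const, hcard, hdprod]
  rw [hρ, hprod] at hle
  have hd0 : (0 : ℝ) < d := by exact_mod_cast Nat.pos_of_ne_zero hd
  exact (div_le_div_iff_of_pos_right hd0).1 hle

/-- For squarefree `d`, `ν(d)/d = ∏_{p ∣ d} ν(p)/p`. [folklore] -/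
theorem rootCount_div_eq_prod_of_squarefree {d : ℕ} (hsq : Squarefree d) :
    (#((range d).filter fun s : ℕ => d ∣ s ^ 3 + 2) : ℝ) / d =
      ∏ p ∈ d.primeFactors, (#((range p).filter fun s : ℕ => p ∣ s ^ 3 + 2) : ℝ) / p := by
  have hd : d ≠ 0 := hsq.ne_zero
  have hmult := isMultiplicative_rootDensity (Polynomial.X ^ 3 + Polynomial.C 2 : Polynomial ℤ)
  have hfac := ArithmeticFunction.IsMultiplicative.multiplicative_factorization _ hmult hd
  rw [Nat.prod_factorization_eq_prod_primeFactors] at hfac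
  rw [rootDensity_apply, polyRootCountMod_eq_card] at hfac
  rw [hfac]
  refine Finset.prod_congr rfl (fun p hp => ?_)
  have hpp := Nat.prime_of_mem_primeFactors hp
  have h1 : d.factorization p = 1 := by
    have hle := (Nat.squarefree_iff_factorization_le_one hd).1 hsq p
    have hpos : 0 < d.factorization p :=
      hpp.factorization_pos_of_dvd hd (Nat.dvd_of_mem_primeFactors hp)
    omega
  rw [h1, pow_one, rootDensity_apply, polyRootCountMod_eq_card]

/-- The squarefree part of `∑_{d ∈ 𝒟} ν(d)/d` is at most the `k`-th elementary symmetric sum of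
`ν(p)/p` over the admissible primes, hence (by `CubicSieve.esymm_le_pow_div_factorial`)
at most `(∑_p ν(p)/p)^k / k!` — Irving's "`∑_{d∈𝒟, μ(d)≠0} ν(d)/d = ∫_T … + o(1) ≤ (1/k!)(…)^k`",
here without passing through integrals. [cite: Irving2014LargestPrimeFactorCubic, §3 (p. 5–6)] -/
theorem sum_squarefree_rootCount_div_le (X z h k : ℕ) :
    ∑ d ∈ ((Icc 1 (3 * X)).filter (fun d : ℕ => ArithmeticFunction.cardFactors d = k ∧
        ∀ p ∈ d.primeFactors, z ≤ p ∧ z ^ (k - 1) * p ^ (h - k + 1) ≤ 10 * X ^ 3)).filter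
          (fun d => Squarefree d),
        (#((range d).filter fun s : ℕ => d ∣ s ^ 3 + 2) : ℝ) / d ≤
      (∑ p ∈ (Nat.primesLE (3 * X)).filter
          (fun p => z ≤ p ∧ z ^ (k - 1) * p ^ (h - k + 1) ≤ 10 * X ^ 3),
        (#((range p).filter fun s : ℕ => p ∣ s ^ 3 + 2) : ℝ) / p) ^ k / k.factorial := by
  classical
  set P := (Nat.primesLE (3 * X)).filter
    (fun p => z ≤ p ∧ z ^ (k - 1) * p ^ (h - k + 1) ≤ 10 * X ^ 3) with hP
  set Dsf := ((Icc 1 (3 * X)).filter (fun d : ℕ => ArithmeticFunction.cardFactors d = k ∧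
    ∀ p ∈ d.primeFactors, z ≤ p ∧ z ^ (k - 1) * p ^ (h - k + 1) ≤ 10 * X ^ 3)).filter
      (fun d => Squarefree d) with hDsf
  set a : ℕ → ℝ := fun p => (#((range p).filter fun s : ℕ => p ∣ s ^ 3 + 2) : ℝ) / p with ha
  have ha0 : ∀ p, 0 ≤ a p := fun p => by rw [ha]; positivity
  -- `d ↦ primeFactors d` is injective on squarefree `d` and lands in `powersetCard k P`
  have hmemD : ∀ d ∈ Dsf, Squarefree d ∧ d.primeFactors ∈ P.powersetCard k := by
    intro d hd
    rw [hDsf, mem_filter, mem_filter, mem_Icc] at hd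
    obtain ⟨⟨⟨hd1, hd3X⟩, hΩ, hpf⟩, hsq⟩ := hd
    refine ⟨hsq, mem_powersetCard.2 ⟨fun p hp => ?_, ?_⟩⟩
    · have hpp := Nat.prime_of_mem_primeFactors hp
      have hple : p ≤ 3 * X := (Nat.le_of_dvd hd1 (Nat.dvd_of_mem_primeFactors hp)).trans hd3X
      rw [hP, mem_filter, Nat.mem_primesLE]
      exact ⟨⟨hple, hpp⟩, hpf p hp⟩
    · rw [← hΩ, ← (ArithmeticFunction.cardDistinctFactors_eq_cardFactors_iff_squarefree
        (by omega)).2 hsq, ArithmeticFunction.cardDistinctFactors_apply, ← List.card_toFinset,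
        Nat.toFinset_factors]
  have hinj : ∀ d₁ ∈ Dsf, ∀ d₂ ∈ Dsf, d₁.primeFactors = d₂.primeFactors → d₁ = d₂ := by
    intro d₁ h₁ d₂ h₂ heq
    rw [← Nat.prod_primeFactors_of_squarefree (hmemD d₁ h₁).1,
      ← Nat.prod_primeFactors_of_squarefree (hmemD d₂ h₂).1, heq]
  calc ∑ d ∈ Dsf, (#((range d).filter fun s : ℕ => d ∣ s ^ 3 + 2) : ℝ) / d
      = ∑ d ∈ Dsf, ∏ p ∈ d.primeFactors, a p :=
        sum_congr rfl (fun d hd => rootCount_div_eq_prod_of_squarefree (hmemD d hd).1)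
    _ = ∑ s ∈ Dsf.image Nat.primeFactors, ∏ p ∈ s, a p := by rw [sum_image hinj]
    _ ≤ ∑ s ∈ P.powersetCard k, ∏ p ∈ s, a p := by
        refine sum_le_sum_of_subset_of_nonneg (fun s hs => ?_) (fun s _ _ => prod_nonneg fun p _ => ha0 p)
        rw [mem_image] at hs
        obtain ⟨d, hd, rfl⟩ := hs
        exact (hmemD d hd).2
    _ ≤ (∑ p ∈ P, a p) ^ k / k.factorial :=
        CubicSieve.esymm_le_pow_div_factorial P a (fun p _ => ha0 p) k

/-- `∑_{1 ≤ d ≤ N, q ∣ d} 1/d ≤ (1 + log N)/q` for `q ≥ 1` (write `d = qm`, `m ≤ N/q ≤ N`, and the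
harmonic bound `∑_{m ≤ M} 1/m ≤ 1 + log M`). [folklore] -/
theorem sum_Icc_filter_dvd_inv_le {N q : ℕ} (hq : 0 < q) (hN : 1 ≤ N) :
    ∑ d ∈ (Icc 1 N).filter (fun d => q ∣ d), (1 : ℝ) / d ≤ (1 + Real.log N) / q := by
  have hq0 : (0 : ℝ) < q := by exact_mod_cast hq
  -- reindex `d = q * m`
  have himg : (Icc 1 N).filter (fun d => q ∣ d) ⊆ (Icc 1 (N / q)).image (fun m => q * m) := by
    intro d hd
    rw [mem_filter, mem_Icc] at hd
    obtain ⟨⟨hd1, hdN⟩, m, rfl⟩ := hd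
    rw [mem_image]
    refine ⟨m, mem_Icc.2 ⟨?_, ?_⟩, rfl⟩
    · rcases Nat.eq_zero_or_pos m with h0 | h0
      · simp [h0] at hd1
      · exact h0
    · exact (Nat.le_div_iff_mul_le hq).2 (by rw [mul_comm]; exact hdN)
  calc ∑ d ∈ (Icc 1 N).filter (fun d => q ∣ d), (1 : ℝ) / d
      ≤ ∑ d ∈ (Icc 1 (N / q)).image (fun m => q * m), (1 : ℝ) / d :=
        sum_le_sum_of_subset_of_nonneg himg (fun d _ _ => by positivity)
    _ = ∑ m ∈ Icc 1 (N / q), (1 : ℝ) / ((q * m : ℕ) : ℝ) := by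
        rw [sum_image (fun m _ m' _ h => Nat.eq_of_mul_eq_mul_left hq h)]
    _ = (1 / q) * ∑ m ∈ Icc 1 (N / q), (m : ℝ)⁻¹ := by
        rw [mul_sum]
        refine sum_congr rfl (fun m _ => ?_)
        push_cast
        rw [one_div, mul_inv, one_div]
    _ ≤ (1 / q) * (1 + Real.log N) := by
        refine mul_le_mul_of_nonneg_left ?_ (by positivity)
        have h1 := harmonic_le_one_add_log (N / q)
        rw [harmonic_eq_sum_Icc] at h1
        push_cast at h1
        refine h1.trans ?_
        rcases Nat.eq_zero_or_pos (N / q) with h0 | h0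
        · rw [h0]; simp; exact Real.log_nonneg (by exact_mod_cast hN)
        · have : Real.log ((N / q : ℕ) : ℝ) ≤ Real.log N :=
            Real.log_le_log (by exact_mod_cast h0) (by exact_mod_cast Nat.div_le_self N q)
          linarith
    _ = (1 + Real.log N) / q := by ring

/-- The non-squarefree part: every non-squarefree `d ∈ 𝒟` is divisible by `p²` for a prime
`p ≥ z`, so `∑_{d∈𝒟, μ(d)=0} ν(d)/d ≤ W^k ∑_{p ≥ z} ∑_{d ≤ 3X, p² ∣ d} 1/d ≤ W^k (1 + log 3X)·(2/z)`
(Irving: "`≪ log X ∑_{X^δ ≤ p} p^{-2} ≪ X^{-δ} log X`"). [cite: Irving2014LargestPrimeFactorCubic, §3 (p. 5)] -/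
theorem sum_nonsquarefree_rootCount_div_le {W : ℕ}
    (hW : ∀ p : ℕ, p.Prime → ∀ a : ℕ, #((range (p ^ a)).filter fun s : ℕ => p ^ a ∣ s ^ 3 + 2) ≤ W)
    (X z h k : ℕ) (hz : 1 ≤ z) (hX : 1 ≤ X) :
    ∑ d ∈ ((Icc 1 (3 * X)).filter (fun d : ℕ => ArithmeticFunction.cardFactors d = k ∧
        ∀ p ∈ d.primeFactors, z ≤ p ∧ z ^ (k - 1) * p ^ (h - k + 1) ≤ 10 * X ^ 3)).filter
          (fun d => ¬ Squarefree d),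
        (#((range d).filter fun s : ℕ => d ∣ s ^ 3 + 2) : ℝ) / d ≤
      (W : ℝ) ^ k * ((1 + Real.log ((3 * X : ℕ) : ℝ)) * (2 / z)) := by
  classical
  set Dns := ((Icc 1 (3 * X)).filter (fun d : ℕ => ArithmeticFunction.cardFactors d = k ∧
    ∀ p ∈ d.primeFactors, z ≤ p ∧ z ^ (k - 1) * p ^ (h - k + 1) ≤ 10 * X ^ 3)).filter
      (fun d => ¬ Squarefree d) with hDns
  set Q := (Nat.primesLE (3 * X)).filter (fun p => z ≤ p) with hQ
  have hW1 : (1 : ℝ) ≤ W := by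
    have := hW 2 Nat.prime_two 0
    simp at this
    exact_mod_cast this
  -- pointwise: `ν(d)/d ≤ W^k / d` and `d` has a prime `p ∈ Q` with `p² ∣ d`
  have hmem : ∀ d ∈ Dns, (1 ≤ d ∧ d ≤ 3 * X) ∧ ArithmeticFunction.cardFactors d = k ∧
      (∀ p ∈ d.primeFactors, z ≤ p) ∧ ∃ p ∈ Q, p ^ 2 ∣ d := by
    intro d hd
    rw [hDns, mem_filter, mem_filter, mem_Icc] at hd
    obtain ⟨⟨⟨hd1, hd3X⟩, hΩ, hpf⟩, hnsq⟩ := hd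
    refine ⟨⟨hd1, hd3X⟩, hΩ, fun p hp => (hpf p hp).1, ?_⟩
    rw [Nat.squarefree_iff_prime_squarefree] at hnsq
    push Not at hnsq
    obtain ⟨p, hpp, hpd⟩ := hnsq
    have hpdvd : p ∣ d := dvd_trans (dvd_mul_right p p) hpd
    have hpmem : p ∈ d.primeFactors := Nat.mem_primeFactors.2 ⟨hpp, hpdvd, by omega⟩
    refine ⟨p, ?_, by rw [pow_two]; exact hpd⟩
    rw [hQ, mem_filter, Nat.mem_primesLE]
    exact ⟨⟨(Nat.le_of_dvd hd1 hpdvd).trans hd3X, hpp⟩, (hpf p hpmem).1⟩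
  have hpt : ∀ d ∈ Dns, (#((range d).filter fun s : ℕ => d ∣ s ^ 3 + 2) : ℝ) / d ≤
      (W : ℝ) ^ k * ∑ p ∈ Q, if p ^ 2 ∣ d then (1 : ℝ) / d else 0 := by
    intro d hd
    obtain ⟨⟨hd1, -⟩, hΩ, -, p, hpQ, hpd⟩ := hmem d hd
    have hν : (#((range d).filter fun s : ℕ => d ∣ s ^ 3 + 2) : ℝ) ≤ (W : ℝ) ^ k := by
      refine (rootCount_le_pow_cardDistinctFactors hW (by omega)).trans ?_
      rw [← hΩ]
      refine pow_le_pow_right₀ hW1 ?_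
      rw [ArithmeticFunction.cardDistinctFactors_apply, ArithmeticFunction.cardFactors_apply]
      exact (List.dedup_sublist _).length_le
    have hsum : (1 : ℝ) / d ≤ ∑ p ∈ Q, if p ^ 2 ∣ d then (1 : ℝ) / d else 0 := by
      rw [← sum_filter]
      have hp' : p ∈ Q.filter (fun p => p ^ 2 ∣ d) := mem_filter.2 ⟨hpQ, hpd⟩
      exact single_le_sum (f := fun _ => (1 : ℝ) / d) (fun _ _ => by positivity) hp'
    have hd0 : (0 : ℝ) < d := by exact_mod_cast hd1
    calc (#((range d).filter fun s : ℕ => d ∣ s ^ 3 + 2) : ℝ) / d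
        ≤ (W : ℝ) ^ k * (1 / d) := by rw [mul_one_div]; exact div_le_div_of_nonneg_right hν hd0.le
      _ ≤ (W : ℝ) ^ k * ∑ p ∈ Q, if p ^ 2 ∣ d then (1 : ℝ) / d else 0 :=
          mul_le_mul_of_nonneg_left hsum (by positivity)
  -- sum over `d`, swap, bound the inner sums
  calc ∑ d ∈ Dns, (#((range d).filter fun s : ℕ => d ∣ s ^ 3 + 2) : ℝ) / d
      ≤ ∑ d ∈ Dns, (W : ℝ) ^ k * ∑ p ∈ Q, if p ^ 2 ∣ d then (1 : ℝ) / d else 0 := sum_le_sum hpt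
    _ = (W : ℝ) ^ k * ∑ p ∈ Q, ∑ d ∈ Dns, if p ^ 2 ∣ d then (1 : ℝ) / d else 0 := by
        rw [← mul_sum, sum_comm]
    _ ≤ (W : ℝ) ^ k * ∑ p ∈ Q, (1 + Real.log ((3 * X : ℕ) : ℝ)) / (p : ℝ) ^ 2 := by
        refine mul_le_mul_of_nonneg_left (sum_le_sum fun p hp => ?_) (by positivity)
        have hpp := (Nat.mem_primesLE.1 (mem_filter.1 hp).1).2
        rw [← sum_filter]
        calc ∑ d ∈ Dns.filter (fun d => p ^ 2 ∣ d), (1 : ℝ) / d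
            ≤ ∑ d ∈ (Icc 1 (3 * X)).filter (fun d => p ^ 2 ∣ d), (1 : ℝ) / d := by
              refine sum_le_sum_of_subset_of_nonneg (fun d hd => ?_) (fun d _ _ => by positivity)
              rw [mem_filter] at hd ⊢
              exact ⟨mem_Icc.2 (hmem d hd.1).1, hd.2⟩
          _ ≤ (1 + Real.log ((3 * X : ℕ) : ℝ)) / ((p ^ 2 : ℕ) : ℝ) :=
              sum_Icc_filter_dvd_inv_le (pow_pos hpp.pos 2) (by omega)
          _ = (1 + Real.log ((3 * X : ℕ) : ℝ)) / (p : ℝ) ^ 2 := by push_cast; ring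
    _ = (W : ℝ) ^ k * ((1 + Real.log ((3 * X : ℕ) : ℝ)) * ∑ p ∈ Q, ((p : ℝ) ^ 2)⁻¹) := by
        congr 1
        rw [mul_sum]
        exact sum_congr rfl (fun p _ => by rw [div_eq_mul_inv])
    _ ≤ (W : ℝ) ^ k * ((1 + Real.log ((3 * X : ℕ) : ℝ)) * (2 / z)) := by
        have hlog : 0 ≤ 1 + Real.log ((3 * X : ℕ) : ℝ) := by
          have : (1 : ℝ) ≤ ((3 * X : ℕ) : ℝ) := by exact_mod_cast (show 1 ≤ 3 * X by omega)
          have := Real.log_nonneg this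
          linarith
        refine mul_le_mul_of_nonneg_left (mul_le_mul_of_nonneg_left ?_ hlog) (by positivity)
        calc ∑ p ∈ Q, ((p : ℝ) ^ 2)⁻¹ ≤ ∑ i ∈ Ioo (z - 1) (3 * X + 1), ((i : ℝ) ^ 2)⁻¹ := by
              refine sum_le_sum_of_subset_of_nonneg (fun p hp => ?_) (fun i _ _ => by positivity)
              rw [hQ, mem_filter, Nat.mem_primesLE] at hp
              rw [mem_Ioo]; omega
          _ ≤ 2 / ((z - 1 : ℕ) + 1 : ℝ) := sum_Ioo_inv_sq_le _ _
          _ = 2 / z := by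
              congr 1
              have : ((z - 1 : ℕ) : ℝ) = (z : ℝ) - 1 := by
                rw [Nat.cast_sub hz]; simp
              rw [this]; ring

/-- `#𝒟 ≤ #{d ≤ 3X : (d, P(z)) = 1} ≤ K(3X/log z + z^{10})` (the tree's upper-bound sieve
`card_roughAP_le` with `q = 1`; Irving: "the total number of integers up to `O(X)` with no prime
factor smaller than `X^δ` … is `O_δ(X/log X)`"). [cite: Irving2014LargestPrimeFactorCubic, §3 (p. 5)] -/
theorem card_divisorSet_le :
    ∃ K : ℝ, 0 < K ∧ ∀ X z h k : ℕ, 2 ≤ z →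
      (#((Icc 1 (3 * X)).filter (fun d : ℕ => ArithmeticFunction.cardFactors d = k ∧
        ∀ p ∈ d.primeFactors, z ≤ p ∧ z ^ (k - 1) * p ^ (h - k + 1) ≤ 10 * X ^ 3)) : ℝ) ≤
        K * ((3 * X : ℕ) / Real.log z + (z : ℝ) ^ (10 : ℕ)) := by
  classical
  obtain ⟨K, hK, h⟩ := card_roughAP_le
  refine ⟨K, hK, fun X z hh k hz => ?_⟩
  have hz2 : (2 : ℝ) ≤ z := by exact_mod_cast hz
  have h1 := h (z : ℝ) hz2 1 Nat.one_pos 0 (Nat.coprime_one_right 0) ((3 * X : ℕ) : ℝ)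
    (by positivity)
  rw [Nat.floor_natCast, Nat.totient_one, Nat.cast_one, one_mul] at h1
  refine le_trans ?_ h1
  gcongr
  -- `𝒟 ⊆ {n ∈ (0, 3X] : n ≡ 0 [MOD 1] ∧ (n, P(z)) = 1}`
  intro d hd
  rw [mem_filter, mem_Icc] at hd
  obtain ⟨⟨hd1, hd3X⟩, -, hpf⟩ := hd
  rw [mem_filter, mem_Ioc]
  refine ⟨⟨hd1, hd3X⟩, Nat.modEq_one, ?_⟩
  rw [coprime_primesProdBelow_iff]
  intro q hq hqd
  rw [Nat.mem_primesBelow, Nat.ceil_natCast] at hq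
  have := (hpf q (Nat.mem_primeFactors.2 ⟨hq.2, hqd, by omega⟩)).1
  omega


/-- **Irving 2015, §3, the bound for `∑_{d∈𝒟_k} A_d` before the analysis** (everything on
p. 5 up to "We begin with the well-known estimate", for a general `k`): with `ν`, `W`
(`ν(p^a) ≤ W`), `K` (sieve constant), `z ≥ 2`, `X ≥ 1`, and
`𝒫_k = {p ≤ 3X prime : z ≤ p, z^{k-1}p^{h-k+1} ≤ 10X³}`,
`∑_{d∈𝒟_k} A_d ≤ X·((∑_{p∈𝒫_k} ν(p)/p)^k/k! + W^k (1 + log 3X)(2/z)) + W^k K (3X/log z + z^{10})`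
(`A_d ≤ ν(d)(X/d + 1)`, squarefree `d` through `e_k`, the others through `p² ∣ d`, and
`∑_{d∈𝒟_k} ν(d) ≤ W^k #𝒟_k`). [cite: Irving2014LargestPrimeFactorCubic, §3 (p. 5)] -/
theorem sum_card_dvd_divisorSet_le :
    ∃ W : ℕ, ∃ K : ℝ, 1 ≤ W ∧ 0 < K ∧
      (∀ p : ℕ, p.Prime → ∀ a : ℕ, #((range (p ^ a)).filter fun s : ℕ => p ^ a ∣ s ^ 3 + 2) ≤ W) ∧
      ∀ X z h k : ℕ, 1 ≤ X → 2 ≤ z →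
      (∑ d ∈ (Icc 1 (3 * X)).filter (fun d : ℕ => ArithmeticFunction.cardFactors d = k ∧
          ∀ p ∈ d.primeFactors, z ≤ p ∧ z ^ (k - 1) * p ^ (h - k + 1) ≤ 10 * X ^ 3),
        (#((Ioc X (2 * X)).filter fun n : ℕ => d ∣ n ^ 3 + 2) : ℝ)) ≤
        X * ((∑ p ∈ (Nat.primesLE (3 * X)).filter
                (fun p => z ≤ p ∧ z ^ (k - 1) * p ^ (h - k + 1) ≤ 10 * X ^ 3),
              (#((range p).filter fun s : ℕ => p ∣ s ^ 3 + 2) : ℝ) / p) ^ k / k.factorial +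
            (W : ℝ) ^ k * ((1 + Real.log ((3 * X : ℕ) : ℝ)) * (2 / z))) +
          (W : ℝ) ^ k * (K * ((3 * X : ℕ) / Real.log z + (z : ℝ) ^ (10 : ℕ))) := by
  classical
  obtain ⟨W, hW1, hW⟩ := exists_rootCount_prime_pow_le
  obtain ⟨K, hK, hD⟩ := card_divisorSet_le
  refine ⟨W, K, hW1, hK, hW, fun X z h k hX hz => ?_⟩
  set D := (Icc 1 (3 * X)).filter (fun d : ℕ => ArithmeticFunction.cardFactors d = k ∧
    ∀ p ∈ d.primeFactors, z ≤ p ∧ z ^ (k - 1) * p ^ (h - k + 1) ≤ 10 * X ^ 3) with hDdef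
  have hW1r : (1 : ℝ) ≤ W := by exact_mod_cast hW1
  -- `A_d ≤ ν(d)(X/d + 1) = X ν(d)/d + ν(d)` and `ν(d) ≤ W^k`
  have hmemD : ∀ d ∈ D, 0 < d ∧ ArithmeticFunction.cardFactors d = k := by
    intro d hd
    rw [hDdef, mem_filter, mem_Icc] at hd
    exact ⟨hd.1.1, hd.2.1⟩
  have hνW : ∀ d ∈ D, (#((range d).filter fun s : ℕ => d ∣ s ^ 3 + 2) : ℝ) ≤ (W : ℝ) ^ k := by
    intro d hd
    obtain ⟨hd0, hΩ⟩ := hmemD d hd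
    refine (rootCount_le_pow_cardDistinctFactors hW hd0.ne').trans ?_
    rw [← hΩ]
    refine pow_le_pow_right₀ hW1r ?_
    rw [ArithmeticFunction.cardDistinctFactors_apply, ArithmeticFunction.cardFactors_apply]
    exact (List.dedup_sublist _).length_le
  have h2 : ∀ d ∈ D, (#((Ioc X (2 * X)).filter fun n : ℕ => d ∣ n ^ 3 + 2) : ℝ) ≤
      X * ((#((range d).filter fun s : ℕ => d ∣ s ^ 3 + 2) : ℝ) / d) + (W : ℝ) ^ k := by
    intro d hd
    obtain ⟨hd0, -⟩ := hmemD d hd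
    have := card_Ioc_filter_dvd_le hd0 X
    have hν0 : (0 : ℝ) ≤ #((range d).filter fun s : ℕ => d ∣ s ^ 3 + 2) := Nat.cast_nonneg _
    calc (#((Ioc X (2 * X)).filter fun n : ℕ => d ∣ n ^ 3 + 2) : ℝ)
        ≤ #((range d).filter fun s : ℕ => d ∣ s ^ 3 + 2) * ((X : ℝ) / d + 1) := this
      _ = X * ((#((range d).filter fun s : ℕ => d ∣ s ^ 3 + 2) : ℝ) / d) +
            #((range d).filter fun s : ℕ => d ∣ s ^ 3 + 2) := by ring
      _ ≤ X * ((#((range d).filter fun s : ℕ => d ∣ s ^ 3 + 2) : ℝ) / d) + (W : ℝ) ^ k := by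
          linarith [hνW d hd]
  -- sum over `D`, split squarefree / not
  have hsplit : ∑ d ∈ D, (#((range d).filter fun s : ℕ => d ∣ s ^ 3 + 2) : ℝ) / d =
      ∑ d ∈ D.filter (fun d => Squarefree d), (#((range d).filter fun s : ℕ => d ∣ s ^ 3 + 2) : ℝ) / d +
      ∑ d ∈ D.filter (fun d => ¬ Squarefree d),
        (#((range d).filter fun s : ℕ => d ∣ s ^ 3 + 2) : ℝ) / d :=
    (sum_filter_add_sum_filter_not D (fun d => Squarefree d) _).symm
  have hsf := sum_squarefree_rootCount_div_le X z h k
  have hnsf := sum_nonsquarefree_rootCount_div_le hW X z h k (by omega) hX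
  have hcard := hD X z h k hz
  have hX0 : (0 : ℝ) ≤ X := Nat.cast_nonneg X
  calc ∑ d ∈ D, (#((Ioc X (2 * X)).filter fun n : ℕ => d ∣ n ^ 3 + 2) : ℝ)
      ≤ ∑ d ∈ D, (X * ((#((range d).filter fun s : ℕ => d ∣ s ^ 3 + 2) : ℝ) / d) + (W : ℝ) ^ k) :=
        sum_le_sum h2
    _ = X * ∑ d ∈ D, (#((range d).filter fun s : ℕ => d ∣ s ^ 3 + 2) : ℝ) / d + (W : ℝ) ^ k * #D := by
        rw [sum_add_distrib, ← mul_sum, sum_const, nsmul_eq_mul]; ring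
    _ ≤ X * ((∑ p ∈ (Nat.primesLE (3 * X)).filter
                (fun p => z ≤ p ∧ z ^ (k - 1) * p ^ (h - k + 1) ≤ 10 * X ^ 3),
              (#((range p).filter fun s : ℕ => p ∣ s ^ 3 + 2) : ℝ) / p) ^ k / k.factorial +
            (W : ℝ) ^ k * ((1 + Real.log ((3 * X : ℕ) : ℝ)) * (2 / z))) +
          (W : ℝ) ^ k * (K * ((3 * X : ℕ) / Real.log z + (z : ℝ) ^ (10 : ℕ))) := by
        rw [hsplit]
        gcongr


/-- **Irving 2015, §3, the bound for `T(h,δ)` before the analysis**: `T ≤ ∑_{d∈𝒟} A_d`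
(`card_largeOmega_le_sum_divisorSet`, `k = [h/3]`) and `sum_card_dvd_divisorSet_le`.
[cite: Irving2014LargestPrimeFactorCubic, §3 (p. 5)] -/
theorem card_largeOmega_le_bound :
    ∃ W : ℕ, ∃ K : ℝ, 1 ≤ W ∧ 0 < K ∧ ∀ X z h : ℕ, 1 ≤ X → 2 ≤ z → 3 ≤ h →
      (#((Ioc X (2 * X)).filter fun n : ℕ =>
          h ≤ ((Nat.primeFactorsList (n ^ 3 + 2)).filter (fun p => z ≤ p)).length) : ℝ) ≤
        X * ((∑ p ∈ (Nat.primesLE (3 * X)).filter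
                (fun p => z ≤ p ∧ z ^ (h / 3 - 1) * p ^ (h - h / 3 + 1) ≤ 10 * X ^ 3),
              (#((range p).filter fun s : ℕ => p ∣ s ^ 3 + 2) : ℝ) / p) ^ (h / 3) / (h / 3).factorial +
            (W : ℝ) ^ (h / 3) * ((1 + Real.log ((3 * X : ℕ) : ℝ)) * (2 / z))) +
          (W : ℝ) ^ (h / 3) * (K * ((3 * X : ℕ) / Real.log z + (z : ℝ) ^ (10 : ℕ))) := by
  classical
  obtain ⟨W, K, hW1, hK, -, hB⟩ := sum_card_dvd_divisorSet_le
  refine ⟨W, K, hW1, hK, fun X z h hX hz hh => ?_⟩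
  have h1 := card_largeOmega_le_sum_divisorSet X z h (by omega) hh
  have h1r : (#((Ioc X (2 * X)).filter fun n : ℕ =>
      h ≤ ((Nat.primeFactorsList (n ^ 3 + 2)).filter (fun p => z ≤ p)).length) : ℝ) ≤
      ∑ d ∈ (Icc 1 (3 * X)).filter (fun d : ℕ => ArithmeticFunction.cardFactors d = h / 3 ∧
          ∀ p ∈ d.primeFactors, z ≤ p ∧ z ^ (h / 3 - 1) * p ^ (h - h / 3 + 1) ≤ 10 * X ^ 3),
        (#((Ioc X (2 * X)).filter fun n : ℕ => d ∣ n ^ 3 + 2) : ℝ) := by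
    exact_mod_cast h1
  exact h1r.trans (hB X z h (h / 3) hX hz)

end DivisorSums

/-! ## Irving's Lemma 3.2: the asymptotic evaluation -/

section TBound

open Filter Topology

/-- **Mertens' second theorem for `ν`, with rate** (the tree's
`DegreeOnePrimes.sum_primesLE_rootCount_div_eq` for `g = x³ + 2`): there are `c, C` with
`|∑_{p ≤ x} ν(p)/p − log log x − c| ≤ C/log² x` for all real `x ≥ 2`. [folklore] -/
theorem exists_sum_rootCount_div_eq :
    ∃ c C : ℝ, ∀ x : ℝ, 2 ≤ x →
      |∑ p ∈ Nat.primesLE ⌊x⌋₊, (#((range p).filter fun s : ℕ => p ∣ s ^ 3 + 2) : ℝ) / p -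
          (Real.log (Real.log x) + c)| ≤ C / Real.log x ^ 2 := by
  obtain ⟨c, C, h⟩ := LFunctions.DegreeOnePrimes.sum_primesLE_rootCount_div_eq
    monic_X_pow_three_add_two.1 irreducible_X_pow_three_add_two 1
  refine ⟨c, C, fun x hx => ?_⟩
  have h1 := h x hx
  have hsum : ∑ p ∈ Nat.primesLE ⌊x⌋₊,
      (#((range p).filter fun n : ℕ => (p : ℤ) ∣
        (Polynomial.X ^ 3 + Polynomial.C 2 : Polynomial ℤ).eval (n : ℤ)) : ℝ) / p =
      ∑ p ∈ Nat.primesLE ⌊x⌋₊, (#((range p).filter fun s : ℕ => p ∣ s ^ 3 + 2) : ℝ) / p := by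
    refine sum_congr rfl (fun p _ => ?_)
    rw [card_filter_dvd_eval_eq_polyRootCountMod, polyRootCountMod_eq_card]
  rw [hsum] at h1
  exact h1.trans (le_of_eq (by norm_num))

/-- Difference of two Mertens sums: for naturals `2 ≤ a ≤ b`,
`∑_{a < p ≤ b} ν(p)/p ≤ log(log b / log a) + 2C/log² a`. [folklore] -/
theorem sum_primesLE_sub_le {c C : ℝ}
    (hM : ∀ x : ℝ, 2 ≤ x →
      |∑ p ∈ Nat.primesLE ⌊x⌋₊, (#((range p).filter fun s : ℕ => p ∣ s ^ 3 + 2) : ℝ) / p -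
          (Real.log (Real.log x) + c)| ≤ C / Real.log x ^ 2)
    {a b : ℕ} (ha : 2 ≤ a) (hab : a ≤ b) :
    ∑ p ∈ Nat.primesLE b, (#((range p).filter fun s : ℕ => p ∣ s ^ 3 + 2) : ℝ) / p -
        ∑ p ∈ Nat.primesLE a, (#((range p).filter fun s : ℕ => p ∣ s ^ 3 + 2) : ℝ) / p ≤
      Real.log (Real.log b / Real.log a) + 2 * C / Real.log a ^ 2 := by
  have ha2 : (2 : ℝ) ≤ a := by exact_mod_cast ha
  have hb2 : (2 : ℝ) ≤ b := by exact_mod_cast (ha.trans hab)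
  have hla : 0 < Real.log a := Real.log_pos (by linarith)
  have hlb : 0 < Real.log b := Real.log_pos (by linarith)
  have hlab : Real.log a ≤ Real.log b := Real.log_le_log (by linarith) (by exact_mod_cast hab)
  have h1 := hM a ha2
  have h2 := hM b hb2
  rw [Nat.floor_natCast] at h1 h2
  have hC0 : 0 ≤ C := by
    have := (abs_nonneg _).trans h1
    have hpos : 0 < Real.log (a : ℝ) ^ 2 := by positivity
    by_contra hneg
    have : C / Real.log (a : ℝ) ^ 2 < 0 := div_neg_of_neg_of_pos (lt_of_not_ge hneg) hpos
    linarith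
  have hCb : C / Real.log (b : ℝ) ^ 2 ≤ C / Real.log (a : ℝ) ^ 2 :=
    div_le_div_of_nonneg_left hC0 (by positivity) (pow_le_pow_left₀ hla.le hlab 2)
  rw [Real.log_div hlb.ne' hla.ne']
  have e1 := (abs_le.1 h1).1
  have e2 := (abs_le.1 h2).2
  have : 2 * C / Real.log (a : ℝ) ^ 2 = C / Real.log (a : ℝ) ^ 2 + C / Real.log (a : ℝ) ^ 2 := by ring
  linarith

/-- `(a + t)^k / k! → a^k / k!` as `t → 0`: for `ε > 0` there is `t > 0` with
`(a + t')^k/k! ≤ a^k/k! + ε` for all `0 ≤ t' ≤ t`. [folklore] -/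
theorem exists_pow_div_factorial_le (a : ℝ) {ε : ℝ} (hε : 0 < ε) (k : ℕ) :
    ∃ t : ℝ, 0 < t ∧ ∀ t' : ℝ, 0 ≤ t' → t' ≤ t →
      (a + t') ^ k / k.factorial ≤ a ^ k / k.factorial + ε := by
  have hcont : Tendsto (fun t : ℝ => (a + t) ^ k / k.factorial) (𝓝 0) (𝓝 (a ^ k / k.factorial)) := by
    have : Continuous (fun t : ℝ => (a + t) ^ k / k.factorial) := by continuity
    simpa using this.tendsto 0
  have hev := hcont.eventually (Iic_mem_nhds (show a ^ k / k.factorial < a ^ k / k.factorial + ε by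
    linarith))
  obtain ⟨r, hr, hball⟩ := Metric.eventually_nhds_iff.1 hev
  refine ⟨r / 2, by positivity, fun t' ht0 htr => ?_⟩
  have : dist t' 0 < r := by
    rw [Real.dist_eq, sub_zero, abs_of_nonneg ht0]; linarith
  exact hball this

/-- Threshold bookkeeping: `Q·(6/ε) ≤ B`, `B, ε > 0` give `Q/B ≤ ε/6`. [folklore] -/
theorem div_le_of_mul_div_le {Q B ε : ℝ} (hε : 0 < ε) (hB : 0 < B) (h : Q * (6 / ε) ≤ B) :
    Q / B ≤ ε / 6 := by
  have h' : Q * 6 ≤ B * ε := by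
    have := mul_le_mul_of_nonneg_right h hε.le
    rwa [mul_assoc, div_mul_cancel₀ _ hε.ne'] at this
  rw [div_le_iff₀ hB]
  linarith

/-- **The core of Irving's Lemma 3.2 for a general `k`**: for `0 < δ ≤ 1/20`,
`(h−k+1)δ ≤ 3 − (k−1)δ` (natural subtraction), `ε > 0`, for all large `X`,
`∑_{d∈𝒟_k(X)} A_d ≤ ((1/k!)(log((3−(k−1)δ)/((h−k+1)δ)))^k + ε)·X`, where `𝒟_k(X)` is the divisor set
with threshold `z = ⌈X^δ⌉`.  Proof: `sum_card_dvd_divisorSet_le`; the admissible primes lie in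
`[z, Z]`, `Z = (10X³/z^{k-1})^{1/(h-k+1)}`, so `∑_{p∈𝒫} ν(p)/p ≤ M(Z) − M(z−1)
= log(log Z/log(z−1)) + O(1/log² z) → log((3−(k−1)δ)/((h−k+1)δ))` by Mertens for `ν`
(`exists_sum_rootCount_div_eq`); the remaining terms are `O(X^{1-δ} log X + X/log X + X^{10δ})`.
[cite: Irving2014LargestPrimeFactorCubic, Lemma 3.2 (proof)] -/
theorem sum_card_dvd_divisorSet_le_eventually {δ : ℝ} (hδ : 0 < δ) (hδ' : δ ≤ 1 / 20)
    {h k : ℕ} (hρ : ((h - k + 1 : ℕ) : ℝ) * δ ≤ 3 - ((k - 1 : ℕ) : ℝ) * δ) {ε : ℝ} (hε : 0 < ε) :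
    ∀ᶠ X : ℕ in atTop,
      (∑ d ∈ (Icc 1 (3 * X)).filter (fun d : ℕ => ArithmeticFunction.cardFactors d = k ∧
          ∀ p ∈ d.primeFactors, ⌈(X : ℝ) ^ δ⌉₊ ≤ p ∧
            ⌈(X : ℝ) ^ δ⌉₊ ^ (k - 1) * p ^ (h - k + 1) ≤ 10 * X ^ 3),
        (#((Ioc X (2 * X)).filter fun n : ℕ => d ∣ n ^ 3 + 2) : ℝ)) ≤
        ((Real.log ((3 - ((k - 1 : ℕ) : ℝ) * δ) / (((h - k + 1 : ℕ) : ℝ) * δ))) ^ k /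
            k.factorial + ε) * X := by
  obtain ⟨W, K, hW1, hK, -, hT⟩ := sum_card_dvd_divisorSet_le
  obtain ⟨c₁, C₁, hM⟩ := exists_sum_rootCount_div_eq
  set m : ℕ := h - k + 1 with hm
  have hm1 : 1 ≤ m := by omega
  have hmr : (1 : ℝ) ≤ m := by exact_mod_cast hm1
  set A : ℝ := 3 - ((k - 1 : ℕ) : ℝ) * δ with hA
  set ρ₀ : ℝ := A / ((m : ℝ) * δ) with hρ₀
  have hmδ : 0 < (m : ℝ) * δ := by positivity
  have hρ1 : 1 ≤ ρ₀ := by rw [hρ₀, le_div_iff₀ hmδ, one_mul]; exact hρ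
  have hA0 : 0 < A := lt_of_lt_of_le hmδ hρ
  set ℓ : ℝ := Real.log ρ₀ with hℓ
  have hℓ0 : 0 ≤ ℓ := Real.log_nonneg hρ1
  -- Mertens constant is nonnegative
  have hC₁ : 0 ≤ C₁ := by
    have := (abs_nonneg _).trans (hM 2 le_rfl)
    have hpos : 0 < Real.log (2 : ℝ) ^ 2 := by positivity
    by_contra hneg
    have : C₁ / Real.log (2 : ℝ) ^ 2 < 0 := div_neg_of_neg_of_pos (lt_of_not_ge hneg) hpos
    linarith
  -- choose `t`: `(ℓ + t')^k/k! ≤ ℓ^k/k! + ε/3` for `t' ≤ t`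
  obtain ⟨t, ht, hcont⟩ := exists_pow_div_factorial_le ℓ (by positivity : 0 < ε / 3) k
  -- `η`: the slack in the ratio and in the Mertens error, `2η ≤ t`, `η ≤ 1`
  set η : ℝ := min 1 (t / 2) with hη
  have hη0 : 0 < η := by rw [hη]; positivity
  have hη1 : η ≤ 1 := min_le_left _ _
  have hηt : 2 * η ≤ t := by have := min_le_right 1 (t / 2); rw [← hη] at this; linarith
  set Wk : ℝ := (W : ℝ) ^ k with hWk
  have hWk1 : 1 ≤ Wk := by rw [hWk]; exact one_le_pow₀ (by exact_mod_cast hW1)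
  -- largeness conditions on `X`, all of the form "a power of `X` (or `log X`) is large"
  have hXδ : Tendsto (fun X : ℕ => (X : ℝ) ^ δ) atTop atTop :=
    (tendsto_rpow_atTop hδ).comp tendsto_natCast_atTop_atTop
  have hXδ2 : Tendsto (fun X : ℕ => (X : ℝ) ^ (δ / 2)) atTop atTop :=
    (tendsto_rpow_atTop (by positivity)).comp tendsto_natCast_atTop_atTop
  have hXhalf : Tendsto (fun X : ℕ => (X : ℝ) ^ ((1 : ℝ) / 2)) atTop atTop :=
    (tendsto_rpow_atTop (by positivity)).comp tendsto_natCast_atTop_atTop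
  have hlogX : Tendsto (fun X : ℕ => Real.log (X : ℝ)) atTop atTop :=
    Real.tendsto_log_atTop.comp tendsto_natCast_atTop_atTop
  filter_upwards [eventually_ge_atTop 1,
    hXδ.eventually_ge_atTop 4,
    hXδ.eventually_ge_atTop (Real.exp (Real.sqrt (2 * C₁ / η)) * 2 + 2),
    hlogX.eventually_ge_atTop ((Real.log 10 + (ρ₀ + η) * m * Real.log 2) / (η * m * δ)),
    hXδ.eventually_ge_atTop (2 * Wk * (1 + Real.log 3) * (6 / ε)),
    hXδ2.eventually_ge_atTop (4 * Wk / δ * (6 / ε)),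
    hlogX.eventually_ge_atTop (3 * Wk * K / δ * (6 / ε)),
    hXhalf.eventually_ge_atTop (1024 * Wk * K * (6 / ε))]
    with X hX1 hz4 hzC hLρ hT1 hT2 hT3 hT4
  -- notation
  have hX0 : (0 : ℝ) < X := by exact_mod_cast hX1
  set L : ℝ := Real.log X with hL
  set z : ℕ := ⌈(X : ℝ) ^ δ⌉₊ with hz
  have hzge : (X : ℝ) ^ δ ≤ z := Nat.le_ceil _
  have hzle : (z : ℝ) ≤ (X : ℝ) ^ δ + 1 := (Nat.ceil_lt_add_one (by positivity)).le
  have hz3 : 3 ≤ z := by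
    have : (3 : ℝ) < z := by linarith only [hzge, hz4]
    exact_mod_cast this.le
  have hz2 : 2 ≤ z := by omega
  have hzr0 : (0 : ℝ) < z := by exact_mod_cast (show 0 < z by omega)
  have hlogz : δ * L ≤ Real.log z := by
    rw [hL, ← Real.log_rpow hX0]; exact Real.log_le_log (by positivity) hzge
  have hz1r : (X : ℝ) ^ δ / 2 ≤ (z : ℝ) - 1 := by linarith only [hzge, hz4]
  have hz1pos : (0 : ℝ) < (z : ℝ) - 1 := by linarith only [hzge, hz4]
  have hlogz1 : δ * L - Real.log 2 ≤ Real.log ((z : ℝ) - 1) := by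
    have : Real.log ((X : ℝ) ^ δ / 2) = δ * L - Real.log 2 := by
      rw [Real.log_div (by positivity) (by norm_num), Real.log_rpow hX0]
    rw [← this]; exact Real.log_le_log (by positivity) hz1r
  -- the main bound from the previous file
  have hmain := hT X z h k hX1 hz2
  -- (1) the prime sum `S ≤ M(Ztop) − M(z−1)`
  set a : ℕ → ℝ := fun p => (#((range p).filter fun s : ℕ => p ∣ s ^ 3 + 2) : ℝ) / p with ha
  have ha0 : ∀ p, 0 ≤ a p := fun p => by rw [ha]; positivity
  set B : ℝ := 10 * (X : ℝ) ^ 3 / (z : ℝ) ^ (k - 1) with hB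
  have hB0 : 0 ≤ B := by positivity
  set Zr : ℝ := B ^ ((m : ℝ)⁻¹) with hZr
  have hZr0 : 0 ≤ Zr := by positivity
  set Ztop : ℕ := max (z - 1) ⌊Zr⌋₊ with hZtop
  have hzZ : z - 1 ≤ Ztop := le_max_left _ _
  have hPsub : (Nat.primesLE (3 * X)).filter
      (fun p => z ≤ p ∧ z ^ (k - 1) * p ^ (h - k + 1) ≤ 10 * X ^ 3) ⊆
      Nat.primesLE Ztop \ Nat.primesLE (z - 1) := by
    intro p hp
    rw [mem_filter, Nat.mem_primesLE] at hp
    obtain ⟨⟨-, hpp⟩, hzp, hbound⟩ := hp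
    refine Finset.mem_sdiff.2 ⟨Nat.mem_primesLE.2 ⟨?_, hpp⟩, fun h' => ?_⟩
    swap
    · have := (Nat.mem_primesLE.1 h').1; omega
    -- `p ≤ ⌊Zr⌋₊`
    refine le_trans ?_ (le_max_right _ _)
    refine Nat.le_floor ?_
    have hpm : ((p : ℝ) ^ m) ≤ B := by
      rw [hB, le_div_iff₀ (by positivity)]
      have : ((z ^ (k - 1) * p ^ (h - k + 1) : ℕ) : ℝ) ≤ ((10 * X ^ 3 : ℕ) : ℝ) := by
        exact_mod_cast hbound
      push_cast at this
      rw [hm]; linarith [this]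
    have hp0 : (0 : ℝ) ≤ p := Nat.cast_nonneg p
    calc (p : ℝ) = ((p : ℝ) ^ m) ^ ((m : ℝ)⁻¹) := (Real.pow_rpow_inv_natCast hp0 (by omega)).symm
      _ ≤ B ^ ((m : ℝ)⁻¹) := Real.rpow_le_rpow (by positivity) hpm (by positivity)
  have hS : ∑ p ∈ (Nat.primesLE (3 * X)).filter
      (fun p => z ≤ p ∧ z ^ (k - 1) * p ^ (h - k + 1) ≤ 10 * X ^ 3), a p ≤
      ∑ p ∈ Nat.primesLE Ztop, a p - ∑ p ∈ Nat.primesLE (z - 1), a p := by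
    have hsub : Nat.primesLE (z - 1) ⊆ Nat.primesLE Ztop := fun p hp => by
      rw [Nat.mem_primesLE] at hp ⊢; exact ⟨hp.1.trans hzZ, hp.2⟩
    rw [← sum_sdiff hsub, add_sub_cancel_right]
    exact sum_le_sum_of_subset_of_nonneg hPsub (fun p _ _ => ha0 p)
  -- (2) Mertens: `M(Ztop) − M(z−1) ≤ log(log Ztop / log (z−1)) + 2C₁/log²(z−1)`
  have hz12 : 2 ≤ z - 1 := by omega
  have hMd := sum_primesLE_sub_le hM hz12 hzZ
  -- (3) the ratio `log Ztop / log(z−1) ≤ ρ₀ + η`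
  have hcast1 : ((z - 1 : ℕ) : ℝ) = (z : ℝ) - 1 := by
    rw [Nat.cast_sub (by omega)]; simp
  have hlz1 : 0 < Real.log ((z : ℝ) - 1) := Real.log_pos (by
    have : (3 : ℝ) ≤ z := by exact_mod_cast hz3
    linarith only [this])
  have hLpos : 0 < δ * L - Real.log 2 := by
    -- `X^δ ≥ 4` gives `δ L ≥ log 4 > log 2`
    have : Real.log 4 ≤ δ * L := by
      rw [hL, ← Real.log_rpow hX0]; exact Real.log_le_log (by norm_num) hz4
    have h42 : Real.log 2 < Real.log 4 := Real.log_lt_log (by norm_num) (by norm_num)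
    linarith only [this, h42]
  have hratio : Real.log (Ztop : ℝ) ≤ (ρ₀ + η) * Real.log ((z : ℝ) - 1) := by
    -- `Ztop ≤ max (z−1) Zr`, so `log Ztop ≤ max (log(z−1)) (log Zr)`
    have hZtop_le : (Ztop : ℝ) ≤ max ((z : ℝ) - 1) Zr := by
      rw [hZtop]; push_cast
      rw [hcast1]
      exact max_le_max le_rfl (Nat.floor_le hZr0)
    have hZtop_pos : (0 : ℝ) < Ztop := by
      have : ((z - 1 : ℕ) : ℝ) ≤ Ztop := by exact_mod_cast hzZ
      rw [hcast1] at this; linarith only [this, hz1pos]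
    have hlogZtop : Real.log (Ztop : ℝ) ≤ max (Real.log ((z : ℝ) - 1)) (Real.log Zr) := by
      rcases le_max_iff.1 hZtop_le with h1 | h1
      · exact le_max_of_le_left (Real.log_le_log hZtop_pos h1)
      · exact le_max_of_le_right (Real.log_le_log hZtop_pos h1)
    have hρη1 : (1 : ℝ) ≤ ρ₀ + η := by linarith only [hρ1, hη0]
    have hρη0 : (0 : ℝ) ≤ ρ₀ + η := by linarith only [hρη1]
    refine hlogZtop.trans (max_le ?_ ?_)
    · -- `log(z−1) ≤ (ρ₀ + η) log(z−1)`
      exact le_mul_of_one_le_left hlz1.le hρη1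
    · -- `log Zr = (log 10 + 3L − (k−1) log z)/m ≤ (log 10 + A L)/m ≤ (ρ₀ + η)(δ L − log 2)`
      rcases eq_or_lt_of_le hB0 with hB00 | hBpos
      · -- `B = 0` is impossible (`X ≥ 1`), but then `Zr = 0` and `log Zr = 0`
        rw [hZr, ← hB00, Real.zero_rpow (by positivity), Real.log_zero]
        exact mul_nonneg hρη0 hlz1.le
      have hlogZr : Real.log Zr = (Real.log 10 + 3 * L - ((k - 1 : ℕ) : ℝ) * Real.log z) / m := by
        rw [hZr, Real.log_rpow hBpos, hB, Real.log_div (by positivity) (by positivity),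
          Real.log_mul (by norm_num) (by positivity), Real.log_pow, Real.log_pow, hL]
        push_cast
        field_simp
      rw [hlogZr, div_le_iff₀ (by positivity)]
      have hk1r : (0 : ℝ) ≤ ((k - 1 : ℕ) : ℝ) := Nat.cast_nonneg _
      have h1 : Real.log 10 + 3 * L - ((k - 1 : ℕ) : ℝ) * Real.log z ≤ Real.log 10 + A * L := by
        have hkl : ((k - 1 : ℕ) : ℝ) * (δ * L) ≤ ((k - 1 : ℕ) : ℝ) * Real.log z :=
          mul_le_mul_of_nonneg_left hlogz hk1r
        rw [hA]
        linarith only [hkl]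
      have h2 : Real.log 10 + A * L ≤ (ρ₀ + η) * (δ * L - Real.log 2) * m := by
        -- uses `ρ₀ m δ = A` and the largeness condition `hLρ`
        have hAm : ρ₀ * m * δ = A := by rw [hρ₀]; field_simp
        have hAmL : ρ₀ * m * δ * L = A * L := by rw [hAm]
        have hL' : (Real.log 10 + (ρ₀ + η) * m * Real.log 2) / (η * m * δ) ≤ L := hLρ
        rw [div_le_iff₀ (by positivity)] at hL'
        linarith only [hAmL, hL']
      calc Real.log 10 + 3 * L - ((k - 1 : ℕ) : ℝ) * Real.log z ≤ Real.log 10 + A * L := h1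
        _ ≤ (ρ₀ + η) * (δ * L - Real.log 2) * m := h2
        _ ≤ (ρ₀ + η) * Real.log ((z : ℝ) - 1) * m := by gcongr
  -- hence `log (log Ztop / log (z−1)) ≤ ℓ + η`
  have hloglog : Real.log (Real.log (Ztop : ℝ) / Real.log ((z - 1 : ℕ) : ℝ)) ≤ ℓ + η := by
    rw [hcast1]
    have hq : Real.log (Ztop : ℝ) / Real.log ((z : ℝ) - 1) ≤ ρ₀ + η := by
      rw [div_le_iff₀ hlz1]; exact hratio
    have hZtop2 : (2 : ℝ) ≤ Ztop := by
      have : ((z - 1 : ℕ) : ℝ) ≤ Ztop := by exact_mod_cast hzZ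
      rw [hcast1] at this
      have h3 : (3 : ℝ) ≤ z := by exact_mod_cast hz3
      linarith only [this, h3]
    have hq0 : 0 < Real.log (Ztop : ℝ) / Real.log ((z : ℝ) - 1) :=
      div_pos (Real.log_pos (by linarith)) hlz1
    calc Real.log (Real.log (Ztop : ℝ) / Real.log ((z : ℝ) - 1))
        ≤ Real.log (ρ₀ + η) := Real.log_le_log hq0 hq
      _ = ℓ + Real.log (1 + η / ρ₀) := by
          rw [hℓ, ← Real.log_mul (by positivity) (by positivity)]
          congr 1; field_simp
      _ ≤ ℓ + η / ρ₀ := by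
          have := Real.log_le_sub_one_of_pos (show 0 < 1 + η / ρ₀ by positivity)
          linarith only [this]
      _ ≤ ℓ + η := by
          have : η / ρ₀ ≤ η := div_le_self hη0.le hρ1
          linarith only [this]
  -- the Mertens error `2C₁/log²(z−1) ≤ η`
  have herr : 2 * C₁ / Real.log ((z - 1 : ℕ) : ℝ) ^ 2 ≤ η := by
    rw [hcast1]
    -- `z − 1 ≥ exp(√(2C₁/η))` hence `log²(z−1) ≥ 2C₁/η`
    have hge : Real.exp (Real.sqrt (2 * C₁ / η)) ≤ (z : ℝ) - 1 := by
      linarith only [hzge, hzC, Real.exp_pos (Real.sqrt (2 * C₁ / η))]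
    have hlog : Real.sqrt (2 * C₁ / η) ≤ Real.log ((z : ℝ) - 1) := by
      rw [Real.le_log_iff_exp_le hz1pos]; exact hge
    have hsq : 2 * C₁ / η ≤ Real.log ((z : ℝ) - 1) ^ 2 := by
      have h0 : 0 ≤ Real.sqrt (2 * C₁ / η) := Real.sqrt_nonneg _
      calc 2 * C₁ / η = Real.sqrt (2 * C₁ / η) ^ 2 := (Real.sq_sqrt (by positivity)).symm
        _ ≤ Real.log ((z : ℝ) - 1) ^ 2 := pow_le_pow_left₀ h0 hlog 2
    rw [div_le_iff₀ (by positivity)]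
    rw [div_le_iff₀ hη0] at hsq
    linarith only [hsq]
  -- so `S ≤ ℓ + 2η ≤ ℓ + t` and `S^k/k! ≤ ℓ^k/k! + ε/3`
  have hSle : ∑ p ∈ (Nat.primesLE (3 * X)).filter
      (fun p => z ≤ p ∧ z ^ (k - 1) * p ^ (h - k + 1) ≤ 10 * X ^ 3), a p ≤ ℓ + 2 * η := by
    linarith only [hS, hMd, hloglog, herr]
  have hS0 : 0 ≤ ∑ p ∈ (Nat.primesLE (3 * X)).filter
      (fun p => z ≤ p ∧ z ^ (k - 1) * p ^ (h - k + 1) ≤ 10 * X ^ 3), a p :=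
    sum_nonneg (fun p _ => ha0 p)
  have hterm1 : (∑ p ∈ (Nat.primesLE (3 * X)).filter
      (fun p => z ≤ p ∧ z ^ (k - 1) * p ^ (h - k + 1) ≤ 10 * X ^ 3), a p) ^ k / k.factorial ≤
      ℓ ^ k / k.factorial + ε / 3 := by
    have h1 : (∑ p ∈ (Nat.primesLE (3 * X)).filter
        (fun p => z ≤ p ∧ z ^ (k - 1) * p ^ (h - k + 1) ≤ 10 * X ^ 3), a p) ^ k / k.factorial ≤
        (ℓ + 2 * η) ^ k / k.factorial :=
      div_le_div_of_nonneg_right (pow_le_pow_left₀ hS0 hSle k) (by positivity)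
    exact h1.trans (hcont (2 * η) (by positivity) hηt)
  -- (4) the error terms
  have hlog3X : 1 + Real.log ((3 * X : ℕ) : ℝ) = 1 + Real.log 3 + L := by
    push_cast
    rw [Real.log_mul (by norm_num) hX0.ne', hL]; ring
  have hLle : L ≤ 2 / δ * (X : ℝ) ^ (δ / 2) := by
    have := Real.log_le_rpow_div hX0.le (by positivity : 0 < δ / 2)
    rw [hL]
    calc Real.log X ≤ (X : ℝ) ^ (δ / 2) / (δ / 2) := this
      _ = 2 / δ * (X : ℝ) ^ (δ / 2) := by field_simp
  have hXδsq : (X : ℝ) ^ (δ / 2) * (X : ℝ) ^ (δ / 2) = (X : ℝ) ^ δ := by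
    rw [← Real.rpow_add hX0]; ring_nf
  have hterm2 : Wk * ((1 + Real.log ((3 * X : ℕ) : ℝ)) * (2 / z)) ≤ ε / 3 := by
    rw [hlog3X]
    have hzX : (X : ℝ) ^ δ ≤ z := hzge
    have hXδ2pos : 0 < (X : ℝ) ^ (δ / 2) := by positivity
    -- `2 Wk (1 + log 3)/z ≤ ε/6`
    have h1 : Wk * (1 + Real.log 3) * (2 / z) ≤ ε / 6 := by
      have := div_le_of_mul_div_le hε hzr0 (hT1.trans hzX)
      calc Wk * (1 + Real.log 3) * (2 / z) = 2 * Wk * (1 + Real.log 3) / z := by ring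
        _ ≤ ε / 6 := this
    -- `2 Wk L / z ≤ (4Wk/δ) X^{δ/2}/X^δ ≤ ε/6`
    have h2 : Wk * L * (2 / z) ≤ ε / 6 := by
      have hWk0 : 0 ≤ Wk := by linarith only [hWk1]
      calc Wk * L * (2 / z) ≤ Wk * (2 / δ * (X : ℝ) ^ (δ / 2)) * (2 / (X : ℝ) ^ δ) := by
            gcongr
        _ = (4 * Wk / δ) / (X : ℝ) ^ (δ / 2) := by
            rw [← hXδsq]; field_simp; ring
        _ ≤ ε / 6 := div_le_of_mul_div_le hε hXδ2pos hT2
    have e : Wk * ((1 + Real.log 3 + L) * (2 / z)) =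
        Wk * (1 + Real.log 3) * (2 / z) + Wk * L * (2 / z) := by ring
    rw [e]
    linarith only [h1, h2]
  have hterm3 : Wk * (K * ((3 * X : ℕ) / Real.log z + (z : ℝ) ^ (10 : ℕ))) ≤ ε / 3 * X := by
    have hlog2 : 0 ≤ Real.log 2 := Real.log_nonneg (by norm_num)
    have hδL : 0 < δ * L := by linarith only [hLpos, hlog2]
    have hL0 : 0 < L := lt_of_mul_lt_mul_left (by simpa using hδL : δ * 0 < δ * L) hδ.le
    have hlogz0 : 0 < Real.log z := lt_of_lt_of_le hδL hlogz
    have hWk0 : 0 ≤ Wk := by linarith only [hWk1]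
    -- `3 Wk K X / log z ≤ 3 Wk K X /(δ L) ≤ (ε/6) X`
    have h1 : Wk * K * ((3 * X : ℕ) / Real.log z) ≤ ε / 6 * X := by
      push_cast
      calc Wk * K * (3 * (X : ℝ) / Real.log z) ≤ Wk * K * (3 * (X : ℝ) / (δ * L)) := by
            gcongr
        _ = (3 * Wk * K / δ) / L * X := by field_simp
        _ ≤ ε / 6 * X :=
            mul_le_mul_of_nonneg_right (div_le_of_mul_div_le hε hL0 hT3) hX0.le
    -- `Wk K z^{10} ≤ Wk K (2X^δ)^{10} ≤ 1024 Wk K X^{1/2} ≤ (ε/6) X`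
    have h2 : Wk * K * (z : ℝ) ^ (10 : ℕ) ≤ ε / 6 * X := by
      have hz2X : (z : ℝ) ≤ 2 * (X : ℝ) ^ δ := by linarith only [hzle, hz4]
      have hpow : (z : ℝ) ^ (10 : ℕ) ≤ 1024 * (X : ℝ) ^ ((1 : ℝ) / 2) := by
        calc (z : ℝ) ^ (10 : ℕ) ≤ (2 * (X : ℝ) ^ δ) ^ (10 : ℕ) := pow_le_pow_left₀ hzr0.le hz2X 10
          _ = 1024 * ((X : ℝ) ^ δ) ^ (10 : ℕ) := by ring
          _ = 1024 * (X : ℝ) ^ (10 * δ) := by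
              rw [← Real.rpow_natCast, ← Real.rpow_mul hX0.le]; ring_nf
          _ ≤ 1024 * (X : ℝ) ^ ((1 : ℝ) / 2) := by
              gcongr
              · exact_mod_cast hX1
              · linarith only [hδ']
      have hXhalfpos : 0 < (X : ℝ) ^ ((1 : ℝ) / 2) := by positivity
      have hXsq : (X : ℝ) ^ ((1 : ℝ) / 2) * (X : ℝ) ^ ((1 : ℝ) / 2) = X := by
        rw [← Real.rpow_add hX0]; norm_num
      have hq : 1024 * Wk * K ≤ ε / 6 * (X : ℝ) ^ ((1 : ℝ) / 2) := by
        have := div_le_of_mul_div_le hε hXhalfpos hT4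
        rwa [div_le_iff₀ hXhalfpos] at this
      calc Wk * K * (z : ℝ) ^ (10 : ℕ) ≤ Wk * K * (1024 * (X : ℝ) ^ ((1 : ℝ) / 2)) := by gcongr
        _ = (1024 * Wk * K) * (X : ℝ) ^ ((1 : ℝ) / 2) := by ring
        _ ≤ (ε / 6 * (X : ℝ) ^ ((1 : ℝ) / 2)) * (X : ℝ) ^ ((1 : ℝ) / 2) :=
            mul_le_mul_of_nonneg_right hq hXhalfpos.le
        _ = ε / 6 * X := by rw [mul_assoc, hXsq]
    calc Wk * (K * ((3 * X : ℕ) / Real.log z + (z : ℝ) ^ (10 : ℕ)))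
        = Wk * K * ((3 * X : ℕ) / Real.log z) + Wk * K * (z : ℝ) ^ (10 : ℕ) := by ring
      _ ≤ ε / 6 * X + ε / 6 * X := add_le_add h1 h2
      _ = ε / 3 * X := by ring
  -- (5) combine
  have hX0' : (0 : ℝ) ≤ X := hX0.le
  calc (∑ d ∈ (Icc 1 (3 * X)).filter (fun d : ℕ => ArithmeticFunction.cardFactors d = k ∧
          ∀ p ∈ d.primeFactors, z ≤ p ∧ z ^ (k - 1) * p ^ (h - k + 1) ≤ 10 * X ^ 3),
        (#((Ioc X (2 * X)).filter fun n : ℕ => d ∣ n ^ 3 + 2) : ℝ))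
      ≤ X * ((∑ p ∈ (Nat.primesLE (3 * X)).filter
                (fun p => z ≤ p ∧ z ^ (k - 1) * p ^ (h - k + 1) ≤ 10 * X ^ 3), a p) ^ k /
              k.factorial + Wk * ((1 + Real.log ((3 * X : ℕ) : ℝ)) * (2 / z))) +
          Wk * (K * ((3 * X : ℕ) / Real.log z + (z : ℝ) ^ (10 : ℕ))) := hmain
    _ ≤ X * (ℓ ^ k / k.factorial + ε / 3 + ε / 3) + ε / 3 * X := by
        gcongr
    _ = (ℓ ^ k / k.factorial + ε) * X := by ring


/-- **Irving 2015, Lemma 3.2** (first estimate for `T(h,δ)`), rational form with an explicit `ε`: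
let `0 < δ ≤ 1/20`, `h ≥ 3`, `k = [h/3]`, and assume `(h−k+1)δ ≤ 3 − (k−1)δ` (i.e. the logarithm
below is `≥ 0`; this holds for `h ≤ 3/δ`, the only range where `T(h,δ) ≠ 0`).  Then for every
`ε > 0`, for all large `X`,
`T(h,δ) = #{n ∈ (X,2X] : n³+2 has ≥ h prime factors ≥ X^δ (with multiplicity)} ≤ (c(h,δ) + ε)·X`,
`c(h,δ) = (1/k!)·(log((3 − (k−1)δ)/((h−k+1)δ)))^k` ("prime factor `≥ X^δ`" is rendered as
`p ≥ ⌈X^δ⌉`): `card_largeOmega_le_sum_divisorSet` and `sum_card_dvd_divisorSet_le_eventually`.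
[cite: Irving2014LargestPrimeFactorCubic, Lemma 3.2] -/
theorem irving_lemma_3_2 {δ : ℝ} (hδ : 0 < δ) (hδ' : δ ≤ 1 / 20) {h : ℕ} (hh : 3 ≤ h)
    (hρ : ((h - h / 3 + 1 : ℕ) : ℝ) * δ ≤ 3 - ((h / 3 - 1 : ℕ) : ℝ) * δ) {ε : ℝ} (hε : 0 < ε) :
    ∀ᶠ X : ℕ in atTop,
      (#((Ioc X (2 * X)).filter fun n : ℕ =>
          h ≤ ((Nat.primeFactorsList (n ^ 3 + 2)).filter
            (fun p => ⌈(X : ℝ) ^ δ⌉₊ ≤ p)).length) : ℝ) ≤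
        ((Real.log ((3 - ((h / 3 - 1 : ℕ) : ℝ) * δ) / (((h - h / 3 + 1 : ℕ) : ℝ) * δ))) ^ (h / 3) /
            (h / 3).factorial + ε) * X := by
  have hev := sum_card_dvd_divisorSet_le_eventually hδ hδ' (h := h) (k := h / 3) hρ hε
  filter_upwards [hev, eventually_ge_atTop 1] with X hX hX1
  refine le_trans ?_ hX
  have hz1 : 1 ≤ ⌈(X : ℝ) ^ δ⌉₊ :=
    Nat.ceil_pos.2 (Real.rpow_pos_of_pos (by exact_mod_cast hX1) δ)
  exact_mod_cast card_largeOmega_le_sum_divisorSet X ⌈(X : ℝ) ^ δ⌉₊ h hz1 hh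

end TBound

end Irving2015

end Literature.NumberTheory.Sieve
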